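import Summits.CriticalPhenomena.CardyFormulaZ2.Theorems.StripClusterRates.Negative.SubmultiplicativeOne

/-!
# Band construction for the two-cluster event: from the product bound to the rate inequality

Crux `StripClusterRates` (stmt-CriticalPhenomena-13878), line two-cluster-rate-is-stationary-gap,
band construction of the lead: once the two-cluster probability `q m = p₂(m, a+b+c+3)` dominates
the product `p₁(m,a)·p₁(m,b)·p₁(m+1,c)` of one-cluster crossing probabilities for every length
`m`, the corresponding exponential rates satisfy `γ₂ ≤ γa + γb + γc`.

This file is the pure real-analysis step, with the dominating sequence `q` kept abstract:

* `band_rate_tendsto_shift`: the shifted rate sequence `-log p₁(m+1,c)/m` has the same limit as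
  `-log p₁(m,c)/m` (write it as `(-log p₁(m+1,c)/(m+1))·((m+1)/m)` for `m ≥ 1` and use
  `band_rate_tendsto_succ_div_self : (m+1)/m → 1`);
* `band_rate_le_of_prod_le`: all factors are positive (`pOne_ge : p₁(m,n) ≥ 2⁻ᵐ`), so take
  logarithms in the product bound, divide by `m` and pass to the limit
  (`le_of_tendsto_of_tendsto'`; at `m = 0` both sides are the junk value `0`).
-/

noncomputable section

open MeasureTheory Filter Topology
open Literature.Probability.LatticeModels Literature.Probability.Percolation

namespace Summit.CriticalPhenomena.CardyFormulaZ2.Cruxes.StripClusterRates.TwoClusterRateIsStationaryGap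

open Summit.CriticalPhenomena.CardyFormulaZ2.Theorems.StripClusterRates.Negative

/-- `(m+1)/m → 1` along the naturals. [folklore] -/
theorem band_rate_tendsto_succ_div_self :
    Tendsto (fun m : ℕ ↦ ((m : ℝ) + 1) / (m : ℝ)) atTop (𝓝 1) := by
  have h : Tendsto (fun m : ℕ ↦ 1 + 1 / (m : ℝ)) atTop (𝓝 (1 + 0)) :=
    tendsto_const_nhds.add tendsto_one_div_atTop_nhds_zero_nat
  rw [add_zero] at h
  refine h.congr' ?_
  filter_upwards [eventually_ge_atTop 1] with m hm
  have : (m : ℝ) ≠ 0 := by exact_mod_cast Nat.one_le_iff_ne_zero.mp hm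
  field_simp

/-- The shifted rate sequence has the same limit: if `-log p₁(m,c)/m → γ` then
`-log p₁(m+1,c)/m → γ` (as `-log p₁(m+1,c)/m = (-log p₁(m+1,c)/(m+1))·((m+1)/m)` for `m ≥ 1`
and `(m+1)/m → 1`). [folklore] -/
theorem band_rate_tendsto_shift {c : ℕ} {γ : ℝ}
    (h : Tendsto (fun m : ℕ ↦ -Real.log (crossingProb half m c) / (m : ℝ)) atTop (𝓝 γ)) :
    Tendsto (fun m : ℕ ↦ -Real.log (crossingProb half (m + 1) c) / (m : ℝ)) atTop (𝓝 γ) := by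
  have h1 : Tendsto (fun m : ℕ ↦ -Real.log (crossingProb half (m + 1) c) / ((m : ℝ) + 1)) atTop
      (𝓝 γ) := by
    refine (h.comp (tendsto_add_atTop_nat 1)).congr fun m ↦ ?_
    simp only [Function.comp_apply, Nat.cast_add, Nat.cast_one]
  have h2 := h1.mul band_rate_tendsto_succ_div_self
  rw [mul_one] at h2
  refine h2.congr' ?_
  filter_upwards [eventually_ge_atTop 1] with m hm
  have hm0 : (m : ℝ) ≠ 0 := by exact_mod_cast Nat.one_le_iff_ne_zero.mp hm
  have hm1 : (m : ℝ) + 1 ≠ 0 := by positivity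
  field_simp

/-- **From the product bound to the rate inequality.** If `q m ≥ p₁(m,a)·p₁(m,b)·p₁(m+1,c)` for
every `m`, and `-log p₁(m,a)/m → γa`, `-log p₁(m,b)/m → γb`, `-log p₁(m,c)/m → γc`,
`-log (q m)/m → γ₂`, then `γ₂ ≤ γa + γb + γc`: take logarithms (all factors are positive as
`p₁(m,n) ≥ 2⁻ᵐ`, tree `pOne_ge`), divide by `m` and pass to the limit, the third factor's shifted
rate sequence having the limit `γc` by `band_rate_tendsto_shift`. [folklore] -/
theorem band_rate_le_of_prod_le : ∀ (a b c : ℕ) (q : ℕ → ℝ) (γa γb γc γ₂ : ℝ),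
    (∀ m : ℕ, crossingProb half m a * crossingProb half m b * crossingProb half (m + 1) c ≤ q m) →
    Tendsto (fun m : ℕ ↦ -Real.log (crossingProb half m a) / (m : ℝ)) atTop (𝓝 γa) →
    Tendsto (fun m : ℕ ↦ -Real.log (crossingProb half m b) / (m : ℝ)) atTop (𝓝 γb) →
    Tendsto (fun m : ℕ ↦ -Real.log (crossingProb half m c) / (m : ℝ)) atTop (𝓝 γc) →
    Tendsto (fun m : ℕ ↦ -Real.log (q m) / (m : ℝ)) atTop (𝓝 γ₂) → γ₂ ≤ γa + γb + γc := by
  intro a b c q γa γb γc γ₂ hq ha hb hc h₂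
  refine le_of_tendsto_of_tendsto' h₂ ((ha.add hb).add (band_rate_tendsto_shift hc)) fun m ↦ ?_
  have hpos : ∀ k n : ℕ, 0 < crossingProb half k n := fun k n ↦
    lt_of_lt_of_le (by positivity) (pOne_ge k n)
  have hpa := hpos m a
  have hpb := hpos m b
  have hpc := hpos (m + 1) c
  have hprod : 0 < crossingProb half m a * crossingProb half m b * crossingProb half (m + 1) c :=
    mul_pos (mul_pos hpa hpb) hpc
  have hlog := Real.log_le_log hprod (hq m)
  rw [Real.log_mul (mul_pos hpa hpb).ne' hpc.ne', Real.log_mul hpa.ne' hpb.ne'] at hlog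
  rw [← add_div, ← add_div]
  exact div_le_div_of_nonneg_right (by linarith) (Nat.cast_nonneg m)

end Summit.CriticalPhenomena.CardyFormulaZ2.Cruxes.StripClusterRates.TwoClusterRateIsStationaryGap

end
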